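import Summits.QuantumFields.YangMills.Theorems.BalabanUVNodesC44IterMhLoopDecomposition
import Literature.MathematicalPhysics.QuantumFieldTheory.Balaban1983to89.BlockAveragingSU2FirstOrder
import HarnessLib

/-!
# (ℓa-C) ROAD B, FILE F4′-3a — ONE AVERAGING STEP IN THE INTERACTION PICTURE, PART 1: the loop factors to first order, the loops of the complex field, and
# [I] (0.8) for `exp[mean log]` AT THE CURVED BACKGROUND LOOP FAMILY (lit ✓`IsAnalyticMean.norm_mlog_expMul_sub_mlog_sub_mean_le`)

Cell `pub-ymgap` ∕ `ym-nodeO-ideate`, porter lineage `ymgap-nodeO-port-PTB-1` (gen 7), hand «(44) for `iterMh`» (director-ym g22 №569/№571; PORT-PLAN-v5 dc7ff9950b0ac185,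
§ F4′-3).  `--kind proof --supports stmt-QuantumFields-27238 --as helper`; count-neutral.  [B7] = [Balaban1985Averaging]; [B11] = [Balaban1985Variational]; [I] = [Balaban1987RG1].

THE MATHEMATICS.  Level `j`: unitary background `W` with (0.4) loops `‖ω − 1‖ ≤ ε`, complex field `Ṽ` with `det Ṽ(b) = 1`, `‖Ṽ(b)W(b)⋆ − 1‖ ≤ s`; `φ ≥ (1+2s)^{dL} − 1` bounds the
staircase factors `‖D(Γ) − 1‖`, `λ ≥ (1+2s)^L − 1` the straight ones.  By F4′-2c the loop factor is `D(loop) = D(Γ)·Ad_{W(Γ)}D([x,x′])·Ad_{ωW(c)}D(Γ′)⁻¹·Ad_ω D(c)⁻¹`; to first order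
(four-factor expansion, inverses `D⁻¹ − 1 = −(D − 1) + O(φ²)`, `Ad_ω = id + O(ε)`):
  `D(loop_i) − 1 = (D(Γ_i) − 1) + Ad_{W(Γ_i)}(D([x_i,x_i′]) − 1) − Ad_{W(c)}(D(Γ′_i) − 1) − (D(c) − 1) + O((φ+λ)² + ε(φ+λ))`  (§2),
and averaging over the (0.4) family `i = (x, σ, σ′)` (§3): `mean_i (D(loop_i) − 1) = Φ(y) + T(c) − Ad_{W(c)}Φ(y′) − (D(c) − 1) + O(…)` with the BLOCK FIELD
`Φ(z) := mean_i (D(Γ^{σ}_{z,x_i}) − 1)` (the same functional at `y′ = emb c₊`, by the `σ ↔ σ′` symmetry of the index family) and `T(c) := mean_i Ad_{W(Γ_i)}(D([x_i,x_i′]) − 1)`,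
`‖T‖ ≤ (1+s)^L − 1` SHARP (§3).  §4: the loops of `Ṽ` stay in the polydisc (`‖Ṽ(loop) − 1‖ ≤ 7(φ+λ) + ε`), and [I] (0.8) at the curved family —
`log eml{D_iω_i} = log eml{ω_i} + mean_i log D_i + O(ε·(φ+λ) + (φ+λ)²)` — is lit's ✓`IsAnalyticMean.norm_mlog_expMul_sub_mlog_sub_mean_le` for ✓`isAnalyticMean_eml`.

WHAT IS PROVED (0 def, 0 sorry, axioms standard; ns `Summit.QuantumFields.YangMills.Theorems.C44IterMh`).
* §1 helpers: `unitary_conj_sub_one`, `norm_unitary_conj_sub_self_le` (`‖UYU⋆ − Y‖ ≤ 2‖U−1‖‖Y‖`), `loopM_coeField_mem_unitaryGroup`, `meanCLM_const_idx`, `norm_meanCLM_sub_le`,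
  `meanCLM_mul_conj`, `meanCLM_idx_swap` (the `σ ↔ σ′` reindexing of the (0.4) family).
* §2 ★★ `norm_loop4_sub_one_sub_lin_le` — the GENERIC four-factor loop expansion to first order (error `11(φ+λ)² + 4ε(φ+λ)`); `norm_loop4_sub_one_le` (`≤ 6(φ+λ)`).
* §3 ★★ `norm_dressLoop_sub_one_le`, ★★★ `norm_mean_dressLoop_sub_main_le` (the mean over the (0.4) family = `Φ(y) + T − Ad_{W(c)}Φ(y′) − (D(c)−1)` up to the error),
  `norm_lineTerm_le` (`‖T‖ ≤ (1+s)^L − 1`), `norm_blockPhi_le` (`‖Φ‖ ≤ φ`).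
* §4 ★ `norm_loopMh_sub_one_le` (loops of `Ṽ`), `det_loopMh_eq_one'`, ★★ `norm_mlog_corrMh_sub_sub_mean_le` ((0.8) at the curved family: `‖log corrMh Ṽ c − log corrM W c − mean log D_i‖ ≤
  10392·ε(φ+λ) + 124560(φ+λ)²`), `norm_mean_mlog_dress_sub_mean_le` (`log D_i` vs `D_i − 1`: `36(φ+λ)²`, lit ✓`MatrixLog.norm_mlog_sub_sub_one_le_sq`).

HONEST FRAMING.  Assemblies of elementary estimates over DEFINED objects and lit's PROVED analytic-mean theorems; nothing of [B7] Props 1–3∕7 or [B11] (44) is asserted beyond what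
is proved here.  (ℓa-C)(ℓa-H)(ℓd) DISPLAYED; (R1)∕(R2) OPEN; K0ᴬ ⟨stmt-QuantumFields-27238⟩ NOT closed; K0ᴬ∕K1ᴬ∕K3ᴬ 0∕3; NODE O 0∕1; COUNT 8∕28 · K 1∕4 UNMOVED; finite `𝕋⁴_{L^K}` at
fixed ε — NOT continuum ∕ ℝ⁴ ∕ OS; **the Yang–Mills mass gap (Clay) is NOT proved by any of this.**  No `sorry`, `instance`, `notation`, `set_option`; standard axioms.
-/

noncomputable section

open scoped Matrix Matrix.Norms.L2Operator

namespace Summit.QuantumFields.YangMills.Theorems.C44IterMh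

open Literature.MathematicalPhysics.QuantumFieldTheory.Balaban1983to89
open Literature.MathematicalPhysics.QuantumFieldTheory.Balaban1983to89.Node00
open T4Continuum BlockAveraging
open B15AveragingHolomorphic (stepMh holMh holMh_nil holMh_cons loopMh corrMh)
open B7TransferAnalyticMean (meanCLM meanCLM_apply norm_meanCLM_apply_le)
open BlockAveragingEMLAnalyticMean (isAnalyticMean_eml)
open MatrixLog (mlog exp_mlog norm_mlog_le_two_mul)
open ExpMeanLog (eml)

variable {P : Params} {j : ℕ} {N : ℕ}

/-! ## §1  Helpers: unitary conjugation defects, means over the (0.4) index family -/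

section Helpers

/-- `UAU⋆ − 1 = U(A − 1)U⋆` for unitary `U`. [cite: Balaban1985Averaging, (56) p.27 (bookkeeping)] -/
theorem unitary_conj_sub_one {U : Matrix (Fin N) (Fin N) ℂ} (hU : U ∈ Matrix.unitaryGroup (Fin N) ℂ) (A : Matrix (Fin N) (Fin N) ℂ) :
    U * A * star U - 1 = U * (A - 1) * star U := by
  rw [mul_sub, sub_mul, mul_one, Unitary.mul_star_self_of_mem hU]

/-- **Conjugation by a NEAR-IDENTITY unitary**: `‖UYU⋆ − Y‖ ≤ 2‖U − 1‖·‖Y‖` (`UYU⋆ − Y = (U−1)YU⋆ + Y(U⋆ − 1)`). [cite: Balaban1985Averaging, (56)–(57) p.27] -/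
theorem norm_unitary_conj_sub_self_le {U : Matrix (Fin N) (Fin N) ℂ} (hU : U ∈ Matrix.unitaryGroup (Fin N) ℂ) (Y : Matrix (Fin N) (Fin N) ℂ) :
    ‖U * Y * star U - Y‖ ≤ 2 * ‖U - 1‖ * ‖Y‖ := by
  have h : U * Y * star U - Y = (U - 1) * (Y * star U) + Y * (star U - 1) := by noncomm_ring
  rw [h]
  calc ‖(U - 1) * (Y * star U) + Y * (star U - 1)‖ ≤ ‖(U - 1) * (Y * star U)‖ + ‖Y * (star U - 1)‖ := norm_add_le _ _
    _ ≤ ‖U - 1‖ * ‖Y * star U‖ + ‖Y‖ * ‖star U - 1‖ := by gcongr <;> exact norm_mul_le _ _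
    _ = 2 * ‖U - 1‖ * ‖Y‖ := by rw [CStarRing.norm_mul_mem_unitary _ (Unitary.star_mem hU), ExpMeanLog.norm_star_sub_one]; ring

variable [NeZero N]

/-- The (0.4) background loop matrices are unitary. [cite: Balaban1987RG1, (0.4) p.253 (bookkeeping)] -/
theorem loopM_coeField_mem_unitaryGroup (W : GaugeField P j (SU N)) (c : PBond P (j + 1)) (i : Idx P) :
    loopM (coeField W) c i ∈ Matrix.unitaryGroup (Fin N) ℂ :=
  holM_coeField_mem_unitaryGroup W _

omit [NeZero N] in
/-- The mean of a constant family is the constant. [folklore] -/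
theorem meanCLM_const_idx {ι : Type*} [Fintype ι] [Nonempty ι] (C : Matrix (Fin N) (Fin N) ℂ) : meanCLM ι (Matrix (Fin N) (Fin N) ℂ) (fun _ => C) = C := by
  rw [meanCLM_apply, Finset.sum_const, Finset.card_univ, ← Nat.cast_smul_eq_nsmul ℂ, smul_smul,
    inv_mul_cancel₀ (Nat.cast_ne_zero.2 Fintype.card_ne_zero), one_smul]

omit [NeZero N] in
/-- Means of pointwise-close families are close: `‖mean x − mean y‖ ≤ B` if `‖x_i − y_i‖ ≤ B` for all `i`. [folklore] -/
theorem norm_meanCLM_sub_le {ι : Type*} [Fintype ι] {x y : ι → Matrix (Fin N) (Fin N) ℂ} {B : ℝ} (hB : 0 ≤ B) (h : ∀ i, ‖x i - y i‖ ≤ B) :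
    ‖meanCLM ι (Matrix (Fin N) (Fin N) ℂ) x - meanCLM ι (Matrix (Fin N) (Fin N) ℂ) y‖ ≤ B := by
  rw [← map_sub]
  exact (norm_meanCLM_apply_le _).trans ((pi_norm_le_iff_of_nonneg hB).2 fun i => h i)

omit [NeZero N] in
/-- Constants pull out of the mean: `mean_i (U x_i V) = U (mean x) V`. [folklore] -/
theorem meanCLM_mul_conj {ι : Type*} [Fintype ι] (U V : Matrix (Fin N) (Fin N) ℂ) (x : ι → Matrix (Fin N) (Fin N) ℂ) :
    meanCLM ι (Matrix (Fin N) (Fin N) ℂ) (fun i => U * x i * V) = U * meanCLM ι (Matrix (Fin N) (Fin N) ℂ) x * V := by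
  rw [meanCLM_apply, meanCLM_apply, ← Finset.sum_mul, ← Finset.mul_sum, mul_smul_comm, smul_mul_assoc]

omit [NeZero N] in
/-- **THE `σ ↔ σ′` SYMMETRY OF THE (0.4) INDEX FAMILY**: a family read through `(r, σ′)` has the same mean as read through `(r, σ)` (reindex by the involution `(r, σ, σ′) ↦ (r, σ′, σ)`).
[cite: Balaban1987RG1, (0.4) p.253] -/
theorem meanCLM_idx_swap (f : (Fin P.d → Fin P.L) → Equiv.Perm (Fin P.d) → Matrix (Fin N) (Fin N) ℂ) :
    meanCLM (Idx P) (Matrix (Fin N) (Fin N) ℂ) (fun i => f i.1 i.2.2) = meanCLM (Idx P) (Matrix (Fin N) (Fin N) ℂ) (fun i => f i.1 i.2.1) := by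
  rw [meanCLM_apply, meanCLM_apply]
  congr 1
  exact Fintype.sum_equiv ((Equiv.refl _).prodCongr (Equiv.prodComm _ _)) _ _ fun i => rfl

end Helpers

/-! ## §2  The generic four-factor loop expansion -/

section Generic

variable [NeZero N]

/-- `‖loop product − 1‖ ≤ 6(φ+λ)`: four rotated factors within `φ, λ, 2φ, 2λ` of `1` (inverses doubled), `3φ + 3λ ≤ 1`. [cite: Balaban1985Averaging, (47) p.25, (20) p.21] -/
theorem norm_loop4_sub_one_le {U₁ U₂ ω D₁ D₂ D₃ D₄ : Matrix (Fin N) (Fin N) ℂ} (hU₁ : U₁ ∈ Matrix.unitaryGroup (Fin N) ℂ) (hU₂ : U₂ ∈ Matrix.unitaryGroup (Fin N) ℂ)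
    (hω : ω ∈ Matrix.unitaryGroup (Fin N) ℂ) (h₃ : IsUnit D₃.det) (h₄ : IsUnit D₄.det) {φ lam : ℝ}
    (hD₁ : ‖D₁ - 1‖ ≤ φ) (hD₂ : ‖D₂ - 1‖ ≤ lam) (hD₃ : ‖D₃ - 1‖ ≤ φ) (hD₄ : ‖D₄ - 1‖ ≤ lam) (hφ : φ ≤ 1 / 2) (hlam : lam ≤ 1 / 2) (hσ : 3 * φ + 3 * lam ≤ 1) :
    ‖D₁ * (U₁ * D₂ * star U₁) * (ω * U₂ * D₃⁻¹ * star (ω * U₂)) * (ω * D₄⁻¹ * star ω) - 1‖ ≤ 6 * (φ + lam) := by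
  have hφ0 : 0 ≤ φ := (norm_nonneg _).trans hD₁
  have hlam0 : 0 ≤ lam := (norm_nonneg _).trans hD₂
  have hA₂ : ‖U₁ * D₂ * star U₁ - 1‖ ≤ lam := by rw [norm_unitary_conj_sub_one_eq hU₁]; exact hD₂
  have hA₃ : ‖ω * U₂ * D₃⁻¹ * star (ω * U₂) - 1‖ ≤ 2 * φ := by
    rw [norm_unitary_conj_sub_one_eq (Submonoid.mul_mem _ hω hU₂)]
    exact norm_inv_sub_one_le_of_det h₃ hD₃ hφ
  have hA₄ : ‖ω * D₄⁻¹ * star ω - 1‖ ≤ 2 * lam := by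
    rw [norm_unitary_conj_sub_one_eq hω]
    exact norm_inv_sub_one_le_of_det h₄ hD₄ hlam
  refine (norm_mul4_sub_one_le hD₁ hA₂ hA₃ hA₄).trans ?_
  have h := prod4_sub_one_le_two_mul hφ0 hlam0 (by linarith) (by linarith) (by linarith : φ + lam + 2 * φ + 2 * lam ≤ 1)
  linarith

/-- ★★ **THE FOUR-FACTOR LOOP EXPANSION TO FIRST ORDER** (generic): for unitary `U₁, U₂, ω` with `‖ω − 1‖ ≤ ε`, determinant-nonzero `D₃, D₄`, and `‖D₁ − 1‖, ‖D₃ − 1‖ ≤ φ`,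
`‖D₂ − 1‖, ‖D₄ − 1‖ ≤ λ` (`φ, λ ≤ 1∕2`, `3φ + 3λ ≤ 1`):
`‖D₁·(U₁D₂U₁⋆)·((ωU₂)D₃⁻¹(ωU₂)⋆)·(ωD₄⁻¹ω⋆) − 1 − [(D₁−1) + U₁(D₂−1)U₁⋆ − U₂(D₃−1)U₂⋆ − (D₄−1)]‖ ≤ 11(φ+λ)² + 4ε(φ+λ)` — the product to first order (F4′-2a), the inverses
to first order, and `Ad_ω = id + O(ε)`; [B7] (111)–(112) along the loop of [I] (0.4), complex edition. [cite: Balaban1985Averaging, (111)–(112) p.34; Balaban1987RG1, (0.4) p.253] -/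
theorem norm_loop4_sub_one_sub_lin_le {U₁ U₂ ω D₁ D₂ D₃ D₄ : Matrix (Fin N) (Fin N) ℂ} (hU₁ : U₁ ∈ Matrix.unitaryGroup (Fin N) ℂ) (hU₂ : U₂ ∈ Matrix.unitaryGroup (Fin N) ℂ)
    (hω : ω ∈ Matrix.unitaryGroup (Fin N) ℂ) (h₃ : IsUnit D₃.det) (h₄ : IsUnit D₄.det) {φ lam ε : ℝ}
    (hD₁ : ‖D₁ - 1‖ ≤ φ) (hD₂ : ‖D₂ - 1‖ ≤ lam) (hD₃ : ‖D₃ - 1‖ ≤ φ) (hD₄ : ‖D₄ - 1‖ ≤ lam) (hωε : ‖ω - 1‖ ≤ ε)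
    (hφ : φ ≤ 1 / 2) (hlam : lam ≤ 1 / 2) (hσ : 3 * φ + 3 * lam ≤ 1) :
    ‖D₁ * (U₁ * D₂ * star U₁) * (ω * U₂ * D₃⁻¹ * star (ω * U₂)) * (ω * D₄⁻¹ * star ω) - 1
        - ((D₁ - 1) + U₁ * (D₂ - 1) * star U₁ - U₂ * (D₃ - 1) * star U₂ - (D₄ - 1))‖ ≤ 11 * (φ + lam) ^ 2 + 4 * ε * (φ + lam) := by
  have hφ0 : 0 ≤ φ := (norm_nonneg _).trans hD₁
  have hlam0 : 0 ≤ lam := (norm_nonneg _).trans hD₂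
  have hε0 : 0 ≤ ε := (norm_nonneg _).trans hωε
  have hωU₂ : ω * U₂ ∈ Matrix.unitaryGroup (Fin N) ℂ := Submonoid.mul_mem _ hω hU₂
  -- the four factors and their deviations
  have hA₂ : ‖U₁ * D₂ * star U₁ - 1‖ ≤ lam := by rw [norm_unitary_conj_sub_one_eq hU₁]; exact hD₂
  have hi₃ : ‖D₃⁻¹ - 1‖ ≤ 2 * φ := norm_inv_sub_one_le_of_det h₃ hD₃ hφ
  have hi₄ : ‖D₄⁻¹ - 1‖ ≤ 2 * lam := norm_inv_sub_one_le_of_det h₄ hD₄ hlam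
  have hA₃ : ‖ω * U₂ * D₃⁻¹ * star (ω * U₂) - 1‖ ≤ 2 * φ := by rw [norm_unitary_conj_sub_one_eq hωU₂]; exact hi₃
  have hA₄ : ‖ω * D₄⁻¹ * star ω - 1‖ ≤ 2 * lam := by rw [norm_unitary_conj_sub_one_eq hω]; exact hi₄
  -- the product to first order
  have hprod := norm_mul4_sub_one_sub_sum_le hD₁ hA₂ hA₃ hA₄
  have htail : (1 + φ) * (1 + lam) * (1 + 2 * φ) * (1 + 2 * lam) - 1 - (φ + lam + 2 * φ + 2 * lam) ≤ (φ + lam + 2 * φ + 2 * lam) ^ 2 :=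
    prod4_sub_one_sub_sum_le_sq hφ0 hlam0 (by linarith) (by linarith) (by linarith)
  -- the third factor to first order: `(A₃ − 1) + U₂(D₃−1)U₂⋆ = [ωYω⋆ − Y] + U₂(D₃⁻¹ − 1 + (D₃ − 1))U₂⋆`, `Y = U₂(D₃⁻¹−1)U₂⋆`
  have hY : ‖U₂ * (D₃⁻¹ - 1) * star U₂‖ ≤ 2 * φ := by rw [norm_unitary_conj hU₂]; exact hi₃
  have h3id : ω * U₂ * D₃⁻¹ * star (ω * U₂) - 1 + U₂ * (D₃ - 1) * star U₂
      = (ω * (U₂ * (D₃⁻¹ - 1) * star U₂) * star ω - U₂ * (D₃⁻¹ - 1) * star U₂) + U₂ * (D₃⁻¹ - 1 + (D₃ - 1)) * star U₂ := by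
    rw [unitary_conj_sub_one hωU₂, star_mul, show ω * U₂ * (D₃⁻¹ - 1) * (star U₂ * star ω) = ω * (U₂ * (D₃⁻¹ - 1) * star U₂) * star ω by simp only [mul_assoc],
      show U₂ * (D₃⁻¹ - 1 + (D₃ - 1)) * star U₂ = U₂ * (D₃⁻¹ - 1) * star U₂ + U₂ * (D₃ - 1) * star U₂ by rw [mul_add, add_mul]]
    abel
  have h3 : ‖ω * U₂ * D₃⁻¹ * star (ω * U₂) - 1 + U₂ * (D₃ - 1) * star U₂‖ ≤ 2 * ε * (2 * φ) + 2 * φ ^ 2 := by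
    rw [h3id]
    refine (norm_add_le _ _).trans (add_le_add ?_ ?_)
    · refine (norm_unitary_conj_sub_self_le hω _).trans ?_
      exact mul_le_mul (by linarith) hY (norm_nonneg _) (by positivity)
    · rw [norm_unitary_conj hU₂]
      exact norm_inv_sub_one_add_le_of_det h₃ hD₃ hφ
  -- the fourth factor to first order
  have h4id : ω * D₄⁻¹ * star ω - 1 + (D₄ - 1) = (ω * (D₄⁻¹ - 1) * star ω - (D₄⁻¹ - 1)) + (D₄⁻¹ - 1 + (D₄ - 1)) := by
    rw [unitary_conj_sub_one hω]
    abel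
  have h4 : ‖ω * D₄⁻¹ * star ω - 1 + (D₄ - 1)‖ ≤ 2 * ε * (2 * lam) + 2 * lam ^ 2 := by
    rw [h4id]
    refine (norm_add_le _ _).trans (add_le_add ?_ ?_)
    · refine (norm_unitary_conj_sub_self_le hω _).trans ?_
      exact mul_le_mul (by linarith) hi₄ (norm_nonneg _) (by positivity)
    · exact norm_inv_sub_one_add_le_of_det h₄ hD₄ hlam
  -- assemble
  have hsplit : D₁ * (U₁ * D₂ * star U₁) * (ω * U₂ * D₃⁻¹ * star (ω * U₂)) * (ω * D₄⁻¹ * star ω) - 1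
        - ((D₁ - 1) + U₁ * (D₂ - 1) * star U₁ - U₂ * (D₃ - 1) * star U₂ - (D₄ - 1))
      = (D₁ * (U₁ * D₂ * star U₁) * (ω * U₂ * D₃⁻¹ * star (ω * U₂)) * (ω * D₄⁻¹ * star ω) - 1
          - ((D₁ - 1) + (U₁ * D₂ * star U₁ - 1) + (ω * U₂ * D₃⁻¹ * star (ω * U₂) - 1) + (ω * D₄⁻¹ * star ω - 1)))
        + (ω * U₂ * D₃⁻¹ * star (ω * U₂) - 1 + U₂ * (D₃ - 1) * star U₂) + (ω * D₄⁻¹ * star ω - 1 + (D₄ - 1)) := by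
    rw [unitary_conj_sub_one hU₁]
    abel
  rw [hsplit]
  calc _ ≤ ‖D₁ * (U₁ * D₂ * star U₁) * (ω * U₂ * D₃⁻¹ * star (ω * U₂)) * (ω * D₄⁻¹ * star ω) - 1
          - ((D₁ - 1) + (U₁ * D₂ * star U₁ - 1) + (ω * U₂ * D₃⁻¹ * star (ω * U₂) - 1) + (ω * D₄⁻¹ * star ω - 1))‖
        + ‖ω * U₂ * D₃⁻¹ * star (ω * U₂) - 1 + U₂ * (D₃ - 1) * star U₂‖ + ‖ω * D₄⁻¹ * star ω - 1 + (D₄ - 1)‖ := norm_add₃_le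
    _ ≤ (φ + lam + 2 * φ + 2 * lam) ^ 2 + (2 * ε * (2 * φ) + 2 * φ ^ 2) + (2 * ε * (2 * lam) + 2 * lam ^ 2) := by linarith
    _ ≤ 11 * (φ + lam) ^ 2 + 4 * ε * (φ + lam) := by nlinarith [mul_nonneg hφ0 hlam0]

end Generic

/-! ## §3  At the (0.4) loop family: the dressed loop factors, their mean, the block field `Φ` and the line term `T` -/

section Loops

variable [NeZero N]

/-- ★★ **THE DRESSED LOOP FACTOR IS WITHIN `6(φ+λ)` OF `1`.** [cite: Balaban1985Averaging, (47) p.25; Balaban1987RG1, (0.4) p.253] -/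
theorem norm_dressLoop_sub_one_le (W : GaugeField P j (SU N)) {V : PBond P j → Matrix (Fin N) (Fin N) ℂ} (hdet : ∀ b, (V b).det = 1) {s φ lam : ℝ}
    (hs : ∀ b, ‖V b * star (W b : Matrix (Fin N) (Fin N) ℂ) - 1‖ ≤ s) (hs2 : s ≤ 1 / 2) (hφ : (1 + 2 * s) ^ (P.d * P.L) - 1 ≤ φ) (hlam : (1 + 2 * s) ^ P.L - 1 ≤ lam)
    (hφ2 : φ ≤ 1 / 2) (hlam2 : lam ≤ 1 / 2) (hσ : 3 * φ + 3 * lam ≤ 1) (c : PBond P (j + 1)) (i : Idx P) :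
    ‖holMh V (walk (emb c.src) (loopWord P.L c.dir (off i.1) i.2.1 i.2.2)) * star (loopM (coeField W) c i) - 1‖ ≤ 6 * (φ + lam) := by
  rw [dress_loop_eq W hdet c i]
  exact norm_loop4_sub_one_le (holM_coeField_mem_unitaryGroup W _) (holM_coeField_mem_unitaryGroup W _) (loopM_coeField_mem_unitaryGroup W c i)
    (sl_isUnit_det (det_dress_eq_one W hdet _)) (sl_isUnit_det (det_dress_eq_one W hdet _))
    ((norm_dress_stair_sub_one_le W hdet hs hs2 _ _ _).trans hφ) ((norm_dress_line_sub_one_le W hdet hs hs2 _ _).trans hlam)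
    ((norm_dress_stair_sub_one_le W hdet hs hs2 _ _ _).trans hφ) ((norm_dress_line_sub_one_le W hdet hs hs2 _ _).trans hlam) hφ2 hlam2 hσ

/-- ★★★ **THE MEAN OF THE DRESSED LOOP FACTORS IS `Φ(y) + T(c) − Ad_{W(c)}Φ(y′) − (D(c) − 1)` TO FIRST ORDER**, with the block field
`Φ(z) = mean_i (D(Γ^{σ_i}_{z,x_i}) − 1)` (read at `y = emb c₋` AND — through the `σ ↔ σ′` symmetry of the family — at `y′ = emb c₊`), the line term
`T(c) = mean_i W(Γ_i)(D([x_i,x_i′]) − 1)W(Γ_i)⋆`, and error `11(φ+λ)² + 4ε(φ+λ)`.  Here lies the COARSE-SITE DRIFT `Φ(y) − Ad_{W(c)}Φ(y′)` that F4′-3b re-gauges away.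
[cite: Balaban1987RG1, (0.4) p.253; Balaban1985Averaging, (111)–(112) p.34, (124)–(125) p.36] -/
theorem norm_mean_dressLoop_sub_main_le (W : GaugeField P j (SU N)) {V : PBond P j → Matrix (Fin N) (Fin N) ℂ} (hdet : ∀ b, (V b).det = 1) {s φ lam ε : ℝ}
    (hs : ∀ b, ‖V b * star (W b : Matrix (Fin N) (Fin N) ℂ) - 1‖ ≤ s) (hs2 : s ≤ 1 / 2) (hφ : (1 + 2 * s) ^ (P.d * P.L) - 1 ≤ φ) (hlam : (1 + 2 * s) ^ P.L - 1 ≤ lam)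
    (hφ2 : φ ≤ 1 / 2) (hlam2 : lam ≤ 1 / 2) (hσ : 3 * φ + 3 * lam ≤ 1) (hε : ∀ c i, ‖loopM (coeField W) c i - 1‖ ≤ ε) (c : PBond P (j + 1)) :
    ‖meanCLM (Idx P) (Matrix (Fin N) (Fin N) ℂ) (fun i => holMh V (walk (emb c.src) (loopWord P.L c.dir (off i.1) i.2.1 i.2.2)) * star (loopM (coeField W) c i) - 1)
      - (meanCLM (Idx P) (Matrix (Fin N) (Fin N) ℂ) (fun i => holMh V (walk (emb c.src) (stairWord i.2.1 (off i.1))) * star (holM (coeField W) (walk (emb c.src) (stairWord i.2.1 (off i.1)))) - 1)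
        + meanCLM (Idx P) (Matrix (Fin N) (Fin N) ℂ) (fun i => holM (coeField W) (walk (emb c.src) (stairWord i.2.1 (off i.1))) *
            (holMh V (walk (walkEnd (emb c.src) (stairWord i.2.1 (off i.1))) (List.replicate P.L (c.dir, true))) *
              star (holM (coeField W) (walk (walkEnd (emb c.src) (stairWord i.2.1 (off i.1))) (List.replicate P.L (c.dir, true)))) - 1) *
            star (holM (coeField W) (walk (emb c.src) (stairWord i.2.1 (off i.1)))))
        - holM (coeField W) (walk (emb c.src) (List.replicate P.L (c.dir, true))) *
            meanCLM (Idx P) (Matrix (Fin N) (Fin N) ℂ) (fun i => holMh V (walk (emb c.tgt) (stairWord i.2.1 (off i.1))) * star (holM (coeField W) (walk (emb c.tgt) (stairWord i.2.1 (off i.1)))) - 1) *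
            star (holM (coeField W) (walk (emb c.src) (List.replicate P.L (c.dir, true))))
        - (holMh V (walk (emb c.src) (List.replicate P.L (c.dir, true))) * star (holM (coeField W) (walk (emb c.src) (List.replicate P.L (c.dir, true)))) - 1))‖
      ≤ 11 * (φ + lam) ^ 2 + 4 * ε * (φ + lam) := by
  haveI : Nonempty (Idx P) := inferInstance
  have hφ0 : 0 ≤ φ := le_trans (by
    have : (1 : ℝ) ≤ (1 + 2 * s) ^ (P.d * P.L) := one_le_pow₀ (by linarith [(norm_nonneg _).trans (hs ⟨emb c.src, c.dir⟩)])
    linarith) hφ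
  have hlam0 : 0 ≤ lam := le_trans (by
    have : (1 : ℝ) ≤ (1 + 2 * s) ^ P.L := one_le_pow₀ (by linarith [(norm_nonneg _).trans (hs ⟨emb c.src, c.dir⟩)])
    linarith) hlam
  have hε0 : 0 ≤ ε := (norm_nonneg _).trans (hε c (Classical.arbitrary _))
  -- rewrite the subtracted expression as ONE mean of a pointwise family
  rw [← meanCLM_idx_swap (fun r σ => holMh V (walk (emb c.tgt) (stairWord σ (off r))) * star (holM (coeField W) (walk (emb c.tgt) (stairWord σ (off r)))) - 1),
    ← meanCLM_mul_conj, ← meanCLM_const_idx (ι := Idx P) (holMh V (walk (emb c.src) (List.replicate P.L (c.dir, true))) *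
      star (holM (coeField W) (walk (emb c.src) (List.replicate P.L (c.dir, true)))) - 1),
    ← map_add, ← map_sub, ← map_sub]
  refine norm_meanCLM_sub_le (by positivity) fun i => ?_
  simp only [Pi.add_apply, Pi.sub_apply]
  rw [dress_loop_eq W hdet c i]
  exact norm_loop4_sub_one_sub_lin_le (holM_coeField_mem_unitaryGroup W _) (holM_coeField_mem_unitaryGroup W _) (loopM_coeField_mem_unitaryGroup W c i)
    (sl_isUnit_det (det_dress_eq_one W hdet _)) (sl_isUnit_det (det_dress_eq_one W hdet _))
    ((norm_dress_stair_sub_one_le W hdet hs hs2 _ _ _).trans hφ) ((norm_dress_line_sub_one_le W hdet hs hs2 _ _).trans hlam)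
    ((norm_dress_stair_sub_one_le W hdet hs hs2 _ _ _).trans hφ) ((norm_dress_line_sub_one_le W hdet hs hs2 _ _).trans hlam) (hε c i) hφ2 hlam2 hσ

/-- `‖T(c)‖ ≤ (1+s)^L − 1` — SHARP: the line term is a mean of unitary conjugates of straight all-forward segment factors (coefficient exactly `L` at first order;
print's `|Q₀A| ≤ |A|` after the `L⁻¹` normalisation). [cite: Balaban1985Averaging, (125)–(126) p.36] -/
theorem norm_lineTerm_le (W : GaugeField P j (SU N)) {V : PBond P j → Matrix (Fin N) (Fin N) ℂ} {s : ℝ}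
    (hs : ∀ b, ‖V b * star (W b : Matrix (Fin N) (Fin N) ℂ) - 1‖ ≤ s) (c : PBond P (j + 1)) :
    ‖meanCLM (Idx P) (Matrix (Fin N) (Fin N) ℂ) (fun i => holM (coeField W) (walk (emb c.src) (stairWord i.2.1 (off i.1))) *
        (holMh V (walk (walkEnd (emb c.src) (stairWord i.2.1 (off i.1))) (List.replicate P.L (c.dir, true))) *
          star (holM (coeField W) (walk (walkEnd (emb c.src) (stairWord i.2.1 (off i.1))) (List.replicate P.L (c.dir, true)))) - 1) *
        star (holM (coeField W) (walk (emb c.src) (stairWord i.2.1 (off i.1)))))‖ ≤ (1 + s) ^ P.L - 1 := by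
  have hs0 : 0 ≤ s := (norm_nonneg _).trans (hs ⟨emb c.src, c.dir⟩)
  have h0 : 0 ≤ (1 + s) ^ P.L - 1 := by linarith [one_le_pow₀ (by linarith : (1 : ℝ) ≤ 1 + s) (n := P.L)]
  refine (norm_meanCLM_apply_le _).trans ((pi_norm_le_iff_of_nonneg h0).2 fun i => ?_)
  rw [norm_unitary_conj (holM_coeField_mem_unitaryGroup W _)]
  exact norm_dress_line_sub_one_le' W hs _ _

/-- `‖Φ(z)‖ ≤ φ` — the block field is a mean of staircase factors. [cite: Balaban1987RG1, (0.3)–(0.4) p.252–253] -/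
theorem norm_blockPhi_le (W : GaugeField P j (SU N)) {V : PBond P j → Matrix (Fin N) (Fin N) ℂ} (hdet : ∀ b, (V b).det = 1) {s φ : ℝ}
    (hs : ∀ b, ‖V b * star (W b : Matrix (Fin N) (Fin N) ℂ) - 1‖ ≤ s) (hs2 : s ≤ 1 / 2) (hφ : (1 + 2 * s) ^ (P.d * P.L) - 1 ≤ φ) (z : Site P j) :
    ‖meanCLM (Idx P) (Matrix (Fin N) (Fin N) ℂ) (fun i => holMh V (walk z (stairWord i.2.1 (off i.1))) * star (holM (coeField W) (walk z (stairWord i.2.1 (off i.1)))) - 1)‖ ≤ φ := by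
  have hφ0 : 0 ≤ φ := le_trans (by
    have : (1 : ℝ) ≤ (1 + 2 * s) ^ (P.d * P.L) := one_le_pow₀ (by linarith [(norm_nonneg _).trans (hs ⟨z, (Classical.arbitrary (Idx P)).2.1 0⟩)])
    linarith) hφ
  refine (norm_meanCLM_apply_le _).trans ((pi_norm_le_iff_of_nonneg hφ0).2 fun i => ?_)
  exact (norm_dress_stair_sub_one_le W hdet hs hs2 z _ _).trans hφ

/-! ## §4  The loops of the complex field; (0.8) for `exp[mean log]` at the curved loop family -/

/-- ★ **THE LOOPS OF THE COMPLEX FIELD STAY IN THE POLYDISC**: `‖Ṽ(loop) − 1‖ ≤ 7(φ+λ) + ε` (`Ṽ(loop) = D(loop)·ω`, `ε ≤ 1∕6`).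
[cite: Balaban1987RG1, (0.4) p.253 («close to the identity»); Balaban1985Averaging, (47) p.25] -/
theorem norm_loopMh_sub_one_le (W : GaugeField P j (SU N)) {V : PBond P j → Matrix (Fin N) (Fin N) ℂ} (hdet : ∀ b, (V b).det = 1) {s φ lam ε : ℝ}
    (hs : ∀ b, ‖V b * star (W b : Matrix (Fin N) (Fin N) ℂ) - 1‖ ≤ s) (hs2 : s ≤ 1 / 2) (hφ : (1 + 2 * s) ^ (P.d * P.L) - 1 ≤ φ) (hlam : (1 + 2 * s) ^ P.L - 1 ≤ lam)
    (hφ2 : φ ≤ 1 / 2) (hlam2 : lam ≤ 1 / 2) (hσ : 3 * φ + 3 * lam ≤ 1) (hε : ∀ c i, ‖loopM (coeField W) c i - 1‖ ≤ ε) (hε6 : ε ≤ 1 / 6) (c : PBond P (j + 1)) (i : Idx P) :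
    ‖loopMh V c i - 1‖ ≤ 7 * (φ + lam) + ε := by
  have hD := norm_dressLoop_sub_one_le W hdet hs hs2 hφ hlam hφ2 hlam2 hσ c i
  have h6 : 0 ≤ 6 * (φ + lam) := (norm_nonneg _).trans hD
  have hmul := norm_mul_sub_one_le_of_le₂ hD (hε c i)
  unfold loopMh
  rw [holMh_eq_dress_mul W V]
  change ‖holMh V (walk (emb c.src) (loopWord P.L c.dir (off i.1) i.2.1 i.2.2)) * star (loopM (coeField W) c i) * loopM (coeField W) c i - 1‖ ≤ _
  refine hmul.trans ?_
  nlinarith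

omit [NeZero N] in
/-- The loops of the complex field have determinant one. [cite: Balaban1985Variational, p.307 («Gᶜ-valued fields»)] -/
theorem det_loopMh_eq_one' {V : PBond P j → Matrix (Fin N) (Fin N) ℂ} (hdet : ∀ b, (V b).det = 1) (c : PBond P (j + 1)) (i : Idx P) : (loopMh V c i).det = 1 :=
  det_holMh_eq_one_SL hdet _

/-- `log D_i` versus `D_i − 1`: `‖mean_i log D(loop_i) − mean_i (D(loop_i) − 1)‖ ≤ 36(φ+λ)²` (series tail (21)∕(26), lit ✓`MatrixLog.norm_mlog_sub_sub_one_le_sq`).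
[cite: Balaban1985Averaging, (21) p.21, (26) p.22] -/
theorem norm_mean_mlog_dress_sub_mean_le (W : GaugeField P j (SU N)) {V : PBond P j → Matrix (Fin N) (Fin N) ℂ} (hdet : ∀ b, (V b).det = 1) {s φ lam : ℝ}
    (hs : ∀ b, ‖V b * star (W b : Matrix (Fin N) (Fin N) ℂ) - 1‖ ≤ s) (hs2 : s ≤ 1 / 2) (hφ : (1 + 2 * s) ^ (P.d * P.L) - 1 ≤ φ) (hlam : (1 + 2 * s) ^ P.L - 1 ≤ lam)
    (hφ2 : φ ≤ 1 / 2) (hlam2 : lam ≤ 1 / 2) (hσ : 3 * φ + 3 * lam ≤ 1) (hκ : 6 * (φ + lam) ≤ 1 / 2) (c : PBond P (j + 1)) :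
    ‖meanCLM (Idx P) (Matrix (Fin N) (Fin N) ℂ) (fun i => mlog (holMh V (walk (emb c.src) (loopWord P.L c.dir (off i.1) i.2.1 i.2.2)) * star (loopM (coeField W) c i)))
      - meanCLM (Idx P) (Matrix (Fin N) (Fin N) ℂ) (fun i => holMh V (walk (emb c.src) (loopWord P.L c.dir (off i.1) i.2.1 i.2.2)) * star (loopM (coeField W) c i) - 1)‖
      ≤ 36 * (φ + lam) ^ 2 := by
  refine norm_meanCLM_sub_le (by positivity) fun i => ?_
  have hD := norm_dressLoop_sub_one_le W hdet hs hs2 hφ hlam hφ2 hlam2 hσ c i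
  refine (MatrixLog.norm_mlog_sub_sub_one_le_sq (hD.trans hκ)).trans ?_
  have h0 := norm_nonneg (holMh V (walk (emb c.src) (loopWord P.L c.dir (off i.1) i.2.1 i.2.2)) * star (loopM (coeField W) c i) - 1)
  nlinarith [mul_le_mul hD hD h0 (by linarith)]

/-- ★★ **[I] (0.8) FOR `exp[mean log]` AT THE CURVED LOOP FAMILY**: with `D_i = D(loop_i)` (so `Ṽ(loop_i) = D_iω_i`, `corrMh Ṽ c = eml{D_iω_i}`, `corrM W c = eml{ω_i}`),
`‖log corrMh Ṽ c − log corrM W c − mean_i log D_i‖ ≤ 866·(12(φ+λ))·ε + 865·(12(φ+λ))²` — lit ✓`IsAnalyticMean.norm_mlog_expMul_sub_mlog_sub_mean_le` for ✓`isAnalyticMean_eml`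
(`r = 1∕3`, `K = 1∕2`), at `Z = ω` (`‖ω − 1‖ ≤ ε ≤ 1∕24`) and `a = log D` (`‖a‖ ≤ 12(φ+λ) ≤ 1∕48`). [cite: Balaban1987RG1, (0.8) p.253; Balaban1985Averaging, (47) p.25] -/
theorem norm_mlog_corrMh_sub_sub_mean_le (W : GaugeField P j (SU N)) {V : PBond P j → Matrix (Fin N) (Fin N) ℂ} (hdet : ∀ b, (V b).det = 1) {s φ lam ε : ℝ}
    (hs : ∀ b, ‖V b * star (W b : Matrix (Fin N) (Fin N) ℂ) - 1‖ ≤ s) (hs2 : s ≤ 1 / 2) (hφ : (1 + 2 * s) ^ (P.d * P.L) - 1 ≤ φ) (hlam : (1 + 2 * s) ^ P.L - 1 ≤ lam)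
    (hφ2 : φ ≤ 1 / 2) (hlam2 : lam ≤ 1 / 2) (hσ : 3 * φ + 3 * lam ≤ 1) (hκ : 12 * (φ + lam) ≤ 1 / 48)
    (hε : ∀ c i, ‖loopM (coeField W) c i - 1‖ ≤ ε) (hε24 : ε ≤ 1 / 24) (c : PBond P (j + 1)) :
    ‖mlog (corrMh V c) - mlog (corrM (coeField W) c)
      - meanCLM (Idx P) (Matrix (Fin N) (Fin N) ℂ) (fun i => mlog (holMh V (walk (emb c.src) (loopWord P.L c.dir (off i.1) i.2.1 i.2.2)) * star (loopM (coeField W) c i)))‖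
      ≤ 866 * (12 * (φ + lam)) * ε + 865 * (12 * (φ + lam)) ^ 2 := by
  haveI : Nonempty (Fin N) := ⟨⟨0, Nat.pos_of_ne_zero (NeZero.ne N)⟩⟩
  have hε0 : 0 ≤ ε := (norm_nonneg _).trans (hε c (Classical.arbitrary _))
  -- the data of lit's lemma: `Z = ω`, `a = log D`
  set Z : Idx P → Matrix (Fin N) (Fin N) ℂ := fun i => loopM (coeField W) c i with hZ
  set a : Idx P → Matrix (Fin N) (Fin N) ℂ := fun i => mlog (holMh V (walk (emb c.src) (loopWord P.L c.dir (off i.1) i.2.1 i.2.2)) * star (loopM (coeField W) c i)) with ha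
  have hZ1 : ‖Z - 1‖ ≤ (1 / 3 : ℝ) / 8 := by
    refine (pi_norm_le_iff_of_nonneg (by norm_num)).2 fun i => ?_
    simp only [Pi.sub_apply, Pi.one_apply, hZ]
    exact (hε c i).trans (by linarith)
  have hZε : ‖Z - 1‖ ≤ ε := (pi_norm_le_iff_of_nonneg hε0).2 fun i => by simp only [Pi.sub_apply, Pi.one_apply, hZ]; exact hε c i
  have hai : ∀ i, ‖a i‖ ≤ 12 * (φ + lam) := fun i => by
    have hD := norm_dressLoop_sub_one_le W hdet hs hs2 hφ hlam hφ2 hlam2 hσ c i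
    exact (norm_mlog_le_two_mul (hD.trans (by linarith))).trans (by linarith)
  have hκ0 : 0 ≤ 12 * (φ + lam) := (norm_nonneg _).trans (hai (Classical.arbitrary _))
  have ha1 : ‖a‖ ≤ 12 * (φ + lam) := (pi_norm_le_iff_of_nonneg hκ0).2 hai
  have ha2 : ‖a‖ ≤ (1 / 3 : ℝ) / 16 := ha1.trans (by linarith)
  have key := (isAnalyticMean_eml (ι := Idx P) (𝔸 := Matrix (Fin N) (Fin N) ℂ)).norm_mlog_expMul_sub_mlog_sub_mean_le hZ1 ha2
  -- identify `eml {exp(a_i) Z_i} = corrMh Ṽ c` and `eml Z = corrM W c`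
  have hfam : (fun i => NormedSpace.exp (a i) * Z i) = fun i => loopMh V c i := by
    funext i
    have hD := norm_dressLoop_sub_one_le W hdet hs hs2 hφ hlam hφ2 hlam2 hσ c i
    simp only [ha, hZ]
    rw [exp_mlog (lt_of_le_of_lt hD (by linarith))]
    exact (holMh_eq_dress_mul W V _).symm
  have hcorr : eml (fun i => NormedSpace.exp (a i) * Z i) = corrMh V c := by rw [hfam]; rfl
  have hcorrW : eml Z = corrM (coeField W) c := rfl
  rw [hcorr, hcorrW] at key
  refine key.trans ?_
  have hnum : (2 + 192 * (1 / 2 : ℝ) / (1 / 3) ^ 2) = 866 := by norm_num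
  have hnum' : (1 + 192 * (1 / 2 : ℝ) / (1 / 3) ^ 2) = 865 := by norm_num
  rw [hnum, hnum']
  have ha0 := norm_nonneg a
  nlinarith [mul_le_mul ha1 hZε (norm_nonneg _) hκ0, mul_le_mul ha1 ha1 ha0 hκ0]

end Loops

end Summit.QuantumFields.YangMills.Theorems.C44IterMh

end
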